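import Summits.AtomisticToContinuum.HydrodynamicLimit.Theorems.LambertianContactSwapLambertianEulerKorolyuk
import Summits.AtomisticToContinuum.HydrodynamicLimit.Theorems.LambertianContactSwapLambertianEulerFirstCollision
import Literature.MathematicalPhysics.KineticTheory.LambertianHardSphereFlow
import Literature.MathematicalPhysics.KineticTheory.HardSphereEuler
import Mathlib.Analysis.SpecificLimits.Basic
import HarnessLib

/-!
# The marked Korolyuk inequality for the Lambertian contact sequence
# (`LambertianContactSwap.LambertianEuler`, stmt-AtomisticToContinuum-11854, line `Sketch`;
# sub-goal `markedContacts_le_meshSum` of the equilibrium floor of CAT-core (i))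

Pathwise (deterministic) step of the equilibrium floor of the collision-activity input CAT-core (i)
of the Lambertian gas.  For the Lambertian hard-sphere recursion of
`Literature.MathematicalPhysics.KineticTheory.LambertianHardSphereFlow` write `t_k = lambertInstant`,
`K_s = lambertCount`, `z_k = lambertStateAfter`, `τ_k = freeExitTime z_k` (`t_{k+1} = t_k + τ_k`),
`Λ_s = lambertFlow` and `z_k♭ = S_{τ_k} z_k` for the exit (pre-collisional) configuration of the `k`-th
free flight.  A MARK is a nonnegative function `wt q y` of a pair `q` and a configuration `y` depending
on `y` only through its velocities.  On a path whose instants are SIMPLE (`τ_k > 0`), do NOT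
ACCUMULATE, and whose exit configurations are simple incoming collision configurations, for a window
`(a', a' + h]` and the mesh `h' = h/(n+1)`, `s_j = a' + j h'`:

* `markedContacts_le_meshSum` (the sub-goal, torus `𝕋³`, diameter `hsDiameter σ N`) and its
  geometry-free form `markedContacts_le_meshSum_of_lipschitz`: for all large `n`,
  `Σ_{m < K_{a'+h}, a' < t_{m+1}} Σ_q 𝟙{q ∈ incomingPairs z_m♭} wt q z_m
    ≤ Σ_{j ≤ n} Σ_q 𝟙{q.1 ≠ q.2, ε ≤ d_q(Λ_{s_j}) ≤ ε + h' ‖Δv_q(Λ_{s_j})‖} wt q Λ_{s_j}`.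
  Indeed once `h'` is below the minimal gap `min_{m<K} τ_m` the counted instants `t_{m+1} ∈ (a', a'+h]`
  lie in pairwise distinct mesh intervals `(s_{j(m)}, s_{j(m)} + h']`, `j(m) = ⌈(t_{m+1} - a')/h'⌉ - 1 ≤ n`,
  with `t_m ≤ s_{j(m)}`; so `Λ_{s_{j(m)}} = S_{s_{j(m)} - t_m} z_m` has the velocities of `z_m` (same
  mark), lies in the domain (`d ≥ ε`), and flows freely in time `t_{m+1} - s_{j(m)} ≤ h'` to the contact
  configuration `z_m♭` of the unique incoming pair `p_m` (`incomingPairs z_m♭ = {p_m}`), whence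
  `d_{p_m}(Λ_{s_{j(m)}}) ≤ ε + h' ‖Δv_{p_m}‖` by the Lipschitz bound of the separation along free flight
  (`…FirstCollision.norm_sepVec_le_norm_sepVec_freeFlight_add` on the torus).  Summing over the
  injection `m ↦ j(m)` (`sum_ite_le_sum_sum_of_injOn`) gives the claim.

References: Daley–Vere-Jones, *An Introduction to the Theory of Point Processes* I, Prop. 3.3.I
(Korolyuk's theorem) and §3.3; C. Cercignani, R. Illner, M. Pulvirenti, *The Mathematical Theory of
Dilute Gases* (1994), App. 4.A (collision-by-collision construction).  All statements [folklore].
-/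

noncomputable section

open scoped BigOperators Topology ENNReal
open MeasureTheory Filter Set
open Literature.MathematicalPhysics.KineticTheory
open Literature.Analysis.FluidPDE Literature.Analysis.FluidPDE.Alexander

namespace Summit.AtomisticToContinuum.HydrodynamicLimit.Theorems.LambertianContactSwapLambertianEulerMarkedKorolyuk

/-! ## Reindexing a marked sum along an injection -/

/-- **Charging lemma.**  If every counted index `m ∈ S` (`c m`) is charged to a cell `J m ∈ T`,
injectively, with `f m ≤ Σ_q g (J m) q`, and all `g j q ≥ 0`, then
`Σ_{m ∈ S} 𝟙{c m} f m ≤ Σ_{j ∈ T} Σ_q g j q`. [folklore] -/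
theorem sum_ite_le_sum_sum_of_injOn {κ : Type*} [Fintype κ] {S T : Finset ℕ} {c : ℕ → Prop}
    [DecidablePred c] {f : ℕ → ℝ} {g : ℕ → κ → ℝ} (J : ℕ → ℕ) (hg : ∀ j q, 0 ≤ g j q)
    (hJ : ∀ m ∈ S, c m → J m ∈ T)
    (hinj : ∀ m₁ ∈ S, c m₁ → ∀ m₂ ∈ S, c m₂ → J m₁ = J m₂ → m₁ = m₂)
    (hle : ∀ m ∈ S, c m → f m ≤ ∑ q, g (J m) q) :
    (∑ m ∈ S, if c m then f m else 0) ≤ ∑ j ∈ T, ∑ q, g j q := by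
  classical
  rw [← Finset.sum_filter]
  have hinj' : Set.InjOn J ↑(S.filter c) := by
    intro m₁ hm₁ m₂ hm₂ hJm
    rw [Finset.coe_filter] at hm₁ hm₂
    exact hinj m₁ hm₁.1 hm₁.2 m₂ hm₂.1 hm₂.2 hJm
  calc ∑ m ∈ S.filter c, f m ≤ ∑ m ∈ S.filter c, ∑ q, g (J m) q :=
        Finset.sum_le_sum fun m hm => by
          rw [Finset.mem_filter] at hm
          exact hle m hm.1 hm.2
    _ = ∑ j ∈ (S.filter c).image J, ∑ q, g j q :=
        (Finset.sum_image (f := fun j => ∑ q, g j q) hinj').symm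
    _ ≤ ∑ j ∈ T, ∑ q, g j q :=
        Finset.sum_le_sum_of_subset_of_nonneg
          (Finset.image_subset_iff.2 fun m hm => by
            rw [Finset.mem_filter] at hm
            exact hJ m hm.1 hm.2)
          fun j _ _ => Finset.sum_nonneg fun q _ => hg j q

/-! ## Pathwise: one counted contact, its segment, and the marked Korolyuk inequality -/

section Pathwise

variable {d : Type*} [Fintype d] {X : Type*} {N : ℕ} {G : Geometry d X} {ε : ℝ}
  {ξs : ℕ → EuclideanSpace ℝ d} {z : Config N d X}

/-- **One contact charged to a mesh time.**  If the separation is Lipschitz along free flight, the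
incoming pairs are exactly `{p}` at the configuration `S_δ y` reached from a domain configuration `y`
by a free flight of duration `0 ≤ δ ≤ h'`, and `w` has the velocities of `y`, then the `p`-mark of `w`
is at most the sum of the marks of `y` over its shell-close pairs
`{q.1 ≠ q.2, ε ≤ d_q(y) ≤ ε + h' ‖Δv_q(y)‖}` (the pair `p` is one of them). [folklore] -/
theorem sum_indicator_le_sum_marks
    (hLip : ∀ (y : Config N d X) (s : ℝ) (i j : Fin N), ‖G.sepVec (y i).1 (y j).1‖ ≤
      ‖G.sepVec ((freeFlight G s y) i).1 ((freeFlight G s y) j).1‖ + |s| * ‖(y i).2 - (y j).2‖)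
    (wt : Fin N × Fin N → Config N d X → ℝ) (hwt0 : ∀ q y, 0 ≤ wt q y)
    (hwtv : ∀ q (y y' : Config N d X), (∀ i, (y i).2 = (y' i).2) → wt q y = wt q y')
    {S : Set (Fin N × Fin N)} {p : Fin N × Fin N} {y w : Config N d X} {δ h' : ℝ}
    (hS : S = {p}) (hp : IsSimpleIncomingWith G ε (freeFlight G δ y) p) (hδ0 : 0 ≤ δ) (hδ : δ ≤ h')
    (hyD : y ∈ hardSphereDomain G N ε) (hvel : ∀ i, (y i).2 = (w i).2) :
    ∑ q, S.indicator (fun q' => wt q' w) q ≤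
      ∑ q : Fin N × Fin N, (if q.1 ≠ q.2 ∧ ε ≤ ‖G.sepVec (y q.1).1 (y q.2).1‖ ∧
          ‖G.sepVec (y q.1).1 (y q.2).1‖ ≤ ε + h' * ‖(y q.1).2 - (y q.2).2‖ then wt q y else 0) := by
  -- the left-hand side is the `p`-mark
  have hsum : ∑ q, S.indicator (fun q' => wt q' w) q = wt p w := by
    rw [hS, Finset.sum_eq_single p]
    · exact Set.indicator_of_mem (Set.mem_singleton p) _
    · exact fun q _ hq => Set.indicator_of_notMem (fun h => hq (Set.mem_singleton_iff.1 h)) _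
    · exact fun h => absurd (Finset.mem_univ p) h
  -- the pair `p` is shell-close in `y`: contact after the flight, Lipschitz bound, domain
  have hcontact : ‖G.sepVec ((freeFlight G δ y) p.1).1 ((freeFlight G δ y) p.2).1‖ = ε :=
    hp.mem_contactSet.2
  have hupper : ‖G.sepVec (y p.1).1 (y p.2).1‖ ≤ ε + h' * ‖(y p.1).2 - (y p.2).2‖ := by
    have hL := hLip y δ p.1 p.2
    rw [hcontact, abs_of_nonneg hδ0] at hL
    have hmul : δ * ‖(y p.1).2 - (y p.2).2‖ ≤ h' * ‖(y p.1).2 - (y p.2).2‖ :=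
      mul_le_mul_of_nonneg_right hδ (norm_nonneg _)
    linarith
  have hcond : p.1 ≠ p.2 ∧ ε ≤ ‖G.sepVec (y p.1).1 (y p.2).1‖ ∧
      ‖G.sepVec (y p.1).1 (y p.2).1‖ ≤ ε + h' * ‖(y p.1).2 - (y p.2).2‖ :=
    ⟨hp.ne, hyD p.1 p.2 hp.ne, hupper⟩
  -- same velocities, same mark; one nonnegative term of the right-hand side
  rw [hsum, hwtv p w y fun i => (hvel i).symm]
  refine le_trans ?_ (Finset.single_le_sum (fun q _ => ?_) (Finset.mem_univ p))
  · rw [if_pos hcond]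
  · split_ifs
    · exact hwt0 _ _
    · exact le_rfl

/-- **Segment data of a counted contact.**  If `t_m ≤ s < t_{m+1}` are finite (`s ≥ 0`), then
`Λ_s = S_{s - t_m} z_m` lies in the hard-sphere domain, has the velocities of `z_m`, and flows freely in
time `t_{m+1} - s` to the exit configuration `z_m♭ = S_{τ_m} z_m`. [folklore] -/
theorem lambertFlow_segment_data {s : ℝ} {m : ℕ} (hs0 : 0 ≤ s)
    (htm : lambertInstant G ε ξs z m ≠ ∞) (htm1 : lambertInstant G ε ξs z (m + 1) ≠ ∞)
    (h1 : (lambertInstant G ε ξs z m).toReal ≤ s) (h2 : s < (lambertInstant G ε ξs z (m + 1)).toReal) :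
    lambertFlow G ε ξs z s =
        freeFlight G (s - (lambertInstant G ε ξs z m).toReal) (lambertStateAfter G ε ξs z m) ∧
      lambertFlow G ε ξs z s ∈ hardSphereDomain G N ε ∧
      freeFlight G ((lambertInstant G ε ξs z (m + 1)).toReal - s) (lambertFlow G ε ξs z s) =
        freeFlight G (freeExitTime G ε (lambertStateAfter G ε ξs z m)).toReal
          (lambertStateAfter G ε ξs z m) ∧
      ∀ i, (lambertFlow G ε ξs z s i).2 = (lambertStateAfter G ε ξs z m i).2 := by
  have hτtop : freeExitTime G ε (lambertStateAfter G ε ξs z m) ≠ ∞ := by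
    rw [lambertInstant_succ] at htm1
    exact (ENNReal.add_ne_top.1 htm1).2
  have hgap : (lambertInstant G ε ξs z (m + 1)).toReal = (lambertInstant G ε ξs z m).toReal +
      (freeExitTime G ε (lambertStateAfter G ε ξs z m)).toReal := by
    rw [lambertInstant_succ, ENNReal.toReal_add htm hτtop]
  have h1' : lambertInstant G ε ξs z m ≤ ENNReal.ofReal s :=
    (ENNReal.le_ofReal_iff_toReal_le htm hs0).2 h1
  have h2' : ENNReal.ofReal s < lambertInstant G ε ξs z (m + 1) :=
    (ENNReal.ofReal_lt_iff_lt_toReal hs0 htm1).2 h2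
  have hflow := lambertFlow_eq_of_segment h1' h2'
  refine ⟨hflow, ?_, ?_, fun i => by rw [hflow, freeFlight_apply]⟩
  · rw [hflow]
    refine freeFlight_mem_hardSphereDomain_of_lt (sub_nonneg.2 h1) ?_
    refine (ENNReal.ofReal_lt_iff_lt_toReal (sub_nonneg.2 h1) hτtop).2 ?_
    linarith
  · rw [hflow, ← freeFlight_add]
    congr 1
    linarith

/-- **The marked Korolyuk inequality, pathwise, for a separation that is Lipschitz along free
flight.**  On a simple (`τ_k > 0`), non-accumulating Lambertian path whose exit configurations are
simple incoming collision configurations, for a nonnegative mark `wt` depending on the configuration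
only through its velocities, a window `(a', a'+h]` (`a' ≥ 0`, `h > 0`) and all large `n`
(`h' = h/(n+1)`, `s_j = a' + j h'`): the sum over the counted contacts `m < K_{a'+h}`, `a' < t_{m+1}`, of
the marks of the incoming pairs of `z_m♭` read on `z_m` is at most the mesh sum over `j ≤ n` and the
shell-close pairs `q` of `Λ_{s_j}` (`q.1 ≠ q.2`, `ε ≤ d_q ≤ ε + h' ‖Δv_q‖`) of the marks of `Λ_{s_j}`.
[folklore] -/
theorem markedContacts_le_meshSum_of_lipschitz
    (hLip : ∀ (y : Config N d X) (s : ℝ) (i j : Fin N), ‖G.sepVec (y i).1 (y j).1‖ ≤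
      ‖G.sepVec ((freeFlight G s y) i).1 ((freeFlight G s y) j).1‖ + |s| * ‖(y i).2 - (y j).2‖)
    (hpos : ∀ k, 0 < freeExitTime G ε (lambertStateAfter G ε ξs z k))
    (hacc : ∀ T : ℝ, ∃ k, ENNReal.ofReal T < lambertInstant G ε ξs z k)
    (hsimple : ∀ k, freeExitTime G ε (lambertStateAfter G ε ξs z k) ≠ ∞ →
      IsSimpleIncoming G ε (freeFlight G (freeExitTime G ε (lambertStateAfter G ε ξs z k)).toReal
        (lambertStateAfter G ε ξs z k)))
    (wt : Fin N × Fin N → Config N d X → ℝ) (hwt0 : ∀ q y, 0 ≤ wt q y)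
    (hwtv : ∀ q (y y' : Config N d X), (∀ i, (y i).2 = (y' i).2) → wt q y = wt q y')
    {a' h : ℝ} (ha' : 0 ≤ a') (hh : 0 < h) :
    ∀ᶠ n : ℕ in atTop,
      (∑ m ∈ Finset.range (lambertCount G ε ξs z (a' + h)),
          if a' < (lambertInstant G ε ξs z (m + 1)).toReal then
            ∑ q : Fin N × Fin N,
              (incomingPairs G ε (freeFlight G
                (freeExitTime G ε (lambertStateAfter G ε ξs z m)).toReal
                (lambertStateAfter G ε ξs z m))).indicator
                (fun q' => wt q' (lambertStateAfter G ε ξs z m)) q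
          else 0) ≤
        ∑ j ∈ Finset.range (n + 1), ∑ q : Fin N × Fin N,
          (if q.1 ≠ q.2 ∧
              ε ≤ ‖G.sepVec (lambertFlow G ε ξs z (a' + (j : ℝ) * (h / ((n : ℝ) + 1))) q.1).1
                  (lambertFlow G ε ξs z (a' + (j : ℝ) * (h / ((n : ℝ) + 1))) q.2).1‖ ∧
              ‖G.sepVec (lambertFlow G ε ξs z (a' + (j : ℝ) * (h / ((n : ℝ) + 1))) q.1).1
                  (lambertFlow G ε ξs z (a' + (j : ℝ) * (h / ((n : ℝ) + 1))) q.2).1‖ ≤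
                ε + (h / ((n : ℝ) + 1)) *
                  ‖(lambertFlow G ε ξs z (a' + (j : ℝ) * (h / ((n : ℝ) + 1))) q.1).2 -
                    (lambertFlow G ε ξs z (a' + (j : ℝ) * (h / ((n : ℝ) + 1))) q.2).2‖
            then wt q (lambertFlow G ε ξs z (a' + (j : ℝ) * (h / ((n : ℝ) + 1))))
            else 0) := by
  set K := lambertCount G ε ξs z (a' + h) with hK
  set t : ℕ → ℝ≥0∞ := lambertInstant G ε ξs z with ht
  set τ : ℕ → ℝ≥0∞ := fun k => freeExitTime G ε (lambertStateAfter G ε ξs z k) with hτ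
  -- nonnegativity of the right-hand side summands
  have hg0 : ∀ (P : Prop) [Decidable P] (x : ℝ), 0 ≤ x → 0 ≤ (if P then x else 0) := by
    intro P _ x hx
    split_ifs
    · exact hx
    · exact le_rfl
  rcases Nat.eq_zero_or_pos K with hK0 | hKpos
  · refine Eventually.of_forall fun n => ?_
    rw [hK0, Finset.range_zero, Finset.sum_empty]
    exact Finset.sum_nonneg fun j _ => Finset.sum_nonneg fun q _ => hg0 _ _ (hwt0 _ _)
  -- the segment of `a' + h`: `t_K ≤ a' + h`, so the first `K + 1` instants and the first `K` gaps are finite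
  have hah : 0 ≤ a' + h := by positivity
  obtain ⟨m₀, hm1, hm2⟩ := LRestart.exists_lambert_segment (hacc (a' + h)) le_rfl
  have hKm : K = m₀ := lambertCount_eq_of_segment hm1 hm2
  have htK : t K ≤ ENNReal.ofReal (a' + h) := by rw [hKm]; exact hm1
  have htop : ∀ k ≤ K, t k ≠ ∞ := fun k hk =>
    ne_top_of_le_ne_top ENNReal.ofReal_ne_top ((monotone_lambertInstant ξs z hk).trans htK)
  have hsucc : ∀ k, t (k + 1) = t k + τ k := fun k => lambertInstant_succ ξs z k
  have hτtop : ∀ k < K, τ k ≠ ∞ := fun k hk => by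
    have h1 := htop (k + 1) hk
    rw [hsucc] at h1
    exact (ENNReal.add_ne_top.1 h1).2
  have hgap : ∀ k < K, (t (k + 1)).toReal = (t k).toReal + (τ k).toReal := fun k hk => by
    rw [hsucc, ENNReal.toReal_add (htop k hk.le) (hτtop k hk)]
  -- the minimal gap `g > 0`
  obtain ⟨k₀, hk₀, hmin⟩ := (Finset.range K).exists_min_image (fun k => (τ k).toReal)
    ⟨0, Finset.mem_range.2 hKpos⟩
  have hk₀K : k₀ < K := Finset.mem_range.1 hk₀
  set g := (τ k₀).toReal with hg
  have hgpos : 0 < g := ENNReal.toReal_pos (hpos k₀).ne' (hτtop k₀ hk₀K)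
  have hming : ∀ k < K, g ≤ (τ k).toReal := fun k hk => hmin k (Finset.mem_range.2 hk)
  -- the counted instants lie in the window and are separated by at least `g`
  have htle : ∀ k < K, (t (k + 1)).toReal ≤ a' + h := fun k hk =>
    ENNReal.toReal_le_of_le_ofReal hah ((monotone_lambertInstant ξs z hk).trans htK)
  have hsep : ∀ k₁ k₂, k₁ < k₂ → k₂ < K → (t (k₁ + 1)).toReal + g ≤ (t (k₂ + 1)).toReal := by
    intro k₁ k₂ h12 h2K
    calc (t (k₁ + 1)).toReal + g ≤ (t (k₁ + 1)).toReal + (τ (k₁ + 1)).toReal := by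
          gcongr; exact hming (k₁ + 1) (by omega)
      _ = (t (k₁ + 1 + 1)).toReal := (hgap (k₁ + 1) (by omega)).symm
      _ ≤ (t (k₂ + 1)).toReal :=
        ENNReal.toReal_mono (htop (k₂ + 1) h2K) (monotone_lambertInstant ξs z (by omega))
  -- fine meshes: `h / (n + 1) < g` eventually
  have hev : ∀ᶠ n : ℕ in atTop, h / ((n : ℝ) + 1) < g := by
    have h1 : Tendsto (fun n : ℕ => h * (1 / ((n : ℝ) + 1))) atTop (𝓝 (h * 0)) :=
      tendsto_one_div_add_atTop_nhds_zero_nat.const_mul h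
    rw [mul_zero] at h1
    filter_upwards [h1.eventually_lt_const hgpos] with n hn
    rwa [← mul_one_div]
  filter_upwards [hev] with n hn
  set h' := h / ((n : ℝ) + 1) with hh'
  have hn1 : (0 : ℝ) < (n : ℝ) + 1 := by positivity
  have hh'pos : 0 < h' := div_pos hh hn1
  have hhn : ((n + 1 : ℕ) : ℝ) * h' = h := by rw [hh']; push_cast; field_simp
  -- the mesh interval `(a' + J k * h', a' + (J k + 1) * h']` of a counted instant `t_{k+1} ∈ (a', a'+h]`
  set J : ℕ → ℕ := fun k => ⌈((t (k + 1)).toReal - a') / h'⌉₊ - 1 with hJ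
  have hcnt : ∀ k < K, a' < (t (k + 1)).toReal →
      J k < n + 1 ∧ a' + (J k : ℝ) * h' < (t (k + 1)).toReal ∧
        (t (k + 1)).toReal ≤ a' + (J k : ℝ) * h' + h' := by
    intro k hk hak
    have hx : 0 < ((t (k + 1)).toReal - a') / h' := div_pos (sub_pos.2 hak) hh'pos
    have hJ1 : J k + 1 = ⌈((t (k + 1)).toReal - a') / h'⌉₊ :=
      Nat.sub_add_cancel (Nat.ceil_pos.2 hx)
    have hJcast : (J k : ℝ) + 1 = (⌈((t (k + 1)).toReal - a') / h'⌉₊ : ℝ) := by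
      exact_mod_cast hJ1
    refine ⟨?_, ?_, ?_⟩
    · have hceil : ⌈((t (k + 1)).toReal - a') / h'⌉₊ ≤ n + 1 := by
        refine Nat.ceil_le.2 ((div_le_iff₀ hh'pos).2 ?_)
        rw [hhn]
        linarith [htle k hk]
      omega
    · have h1 : (⌈((t (k + 1)).toReal - a') / h'⌉₊ : ℝ) < ((t (k + 1)).toReal - a') / h' + 1 :=
        Nat.ceil_lt_add_one hx.le
      rw [← hJcast] at h1
      have h2 : (J k : ℝ) < ((t (k + 1)).toReal - a') / h' := by linarith
      rw [lt_div_iff₀ hh'pos] at h2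
      linarith
    · have h1 : ((t (k + 1)).toReal - a') / h' ≤ (⌈((t (k + 1)).toReal - a') / h'⌉₊ : ℝ) :=
        Nat.le_ceil _
      rw [← hJcast, div_le_iff₀ hh'pos] at h1
      linarith
  -- charge each counted contact to its mesh interval
  refine sum_ite_le_sum_sum_of_injOn J (fun j q => hg0 _ _ (hwt0 _ _))
    (fun m hm hcm => Finset.mem_range.2 (hcnt m (Finset.mem_range.1 hm) hcm).1)
    (fun m₁ hm₁ hc₁ m₂ hm₂ hc₂ hJeq => ?_) (fun m hm hcm => ?_)
  · -- distinct counted instants lie in distinct mesh intervals (`h' < g`)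
    have hm₁K := Finset.mem_range.1 hm₁
    have hm₂K := Finset.mem_range.1 hm₂
    by_contra hne
    rcases lt_or_gt_of_ne hne with hlt | hgt
    · have h1 := (hcnt m₁ hm₁K hc₁).2.1
      have h2 := (hcnt m₂ hm₂K hc₂).2.2
      have h3 := hsep m₁ m₂ hlt hm₂K
      rw [hJeq] at h1
      linarith
    · have h1 := (hcnt m₂ hm₂K hc₂).2.1
      have h2 := (hcnt m₁ hm₁K hc₁).2.2
      have h3 := hsep m₂ m₁ hgt hm₁K
      rw [← hJeq] at h1
      linarith
  · -- a counted contact `m`: the segment of its mesh time, the unique incoming pair, the charge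
    have hmK := Finset.mem_range.1 hm
    obtain ⟨-, hJlt, hJle⟩ := hcnt m hmK hcm
    have hs0 : 0 ≤ a' + (J m : ℝ) * h' := add_nonneg ha' (mul_nonneg (Nat.cast_nonneg _) hh'pos.le)
    have htm : (t m).toReal ≤ a' + (J m : ℝ) * h' := by
      have e1 := hgap m hmK
      have e2 := hming m hmK
      linarith
    obtain ⟨-, hyD, hexit, hvel⟩ :=
      lambertFlow_segment_data hs0 (htop m hmK.le) (htop (m + 1) hmK) htm hJlt
    obtain ⟨p, hp⟩ := isSimpleIncoming_iff.1 (hsimple m (hτtop m hmK))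
    have hS := hp.incomingPairs_eq
    rw [← hexit] at hp
    exact sum_indicator_le_sum_marks hLip wt hwt0 hwtv hS hp (sub_nonneg.2 hJlt.le) (by linarith)
      hyD hvel

end Pathwise

/-! ## The sub-goal: the torus `𝕋³` at fixed reduced density -/

/-- **M1: the pathwise marked Korolyuk inequality** (registered sub-goal `markedContacts_le_meshSum` of
lead c9, line `Sketch`, crux stmt-AtomisticToContinuum-11854; the equilibrium floor of CAT-core (i)).
On a simple, non-accumulating Lambertian path from the hard-sphere domain of `N + 1` spheres of
diameter `hsDiameter σ N` in `𝕋³` whose exit configurations are simple incoming, the incoming-pair-marked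
sum over the contacts of a window `(a', a'+h]` is eventually (in the mesh `h' = h/(n+1)`) dominated by
the mesh sum of the marks over the shell-close pairs `ε ≤ d_q ≤ ε + h' ‖Δv_q‖` read at the mesh times
`a' + j h'` (`markedContacts_le_meshSum_of_lipschitz` with the torus Lipschitz bound
`norm_sepVec_le_norm_sepVec_freeFlight_add`). [folklore] -/
theorem markedContacts_le_meshSum :
    ∀ {σ : ℝ}, 0 < σ → σ < 2⁻¹ → ∀ (N : ℕ) (z : Config (N + 1) (Fin 3) T3) (ξs : ℕ → V3),
      z ∈ hardSphereDomain (Torus.geometry (Fin 3)) (N + 1) (hsDiameter σ N) →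
      (∀ k : ℕ, 0 < freeExitTime (Torus.geometry (Fin 3)) (hsDiameter σ N)
          (lambertStateAfter (Torus.geometry (Fin 3)) (hsDiameter σ N) ξs z k)) →
      (∀ T : ℝ, ∃ k, ENNReal.ofReal T < lambertInstant (Torus.geometry (Fin 3)) (hsDiameter σ N) ξs z k) →
      (∀ k : ℕ, freeExitTime (Torus.geometry (Fin 3)) (hsDiameter σ N)
            (lambertStateAfter (Torus.geometry (Fin 3)) (hsDiameter σ N) ξs z k) ≠ ⊤ →
          IsSimpleIncoming (Torus.geometry (Fin 3)) (hsDiameter σ N)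
            (freeFlight (Torus.geometry (Fin 3))
              (freeExitTime (Torus.geometry (Fin 3)) (hsDiameter σ N)
                (lambertStateAfter (Torus.geometry (Fin 3)) (hsDiameter σ N) ξs z k)).toReal
              (lambertStateAfter (Torus.geometry (Fin 3)) (hsDiameter σ N) ξs z k))) →
      ∀ (wt : Fin (N + 1) × Fin (N + 1) → Config (N + 1) (Fin 3) T3 → ℝ), (∀ q y, 0 ≤ wt q y) →
        (∀ q (y y' : Config (N + 1) (Fin 3) T3), (∀ i, (y i).2 = (y' i).2) → wt q y = wt q y') →
        ∀ (a' h : ℝ), 0 ≤ a' → 0 < h →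
          ∀ᶠ n : ℕ in Filter.atTop,
            (∑ m ∈ Finset.range (lambertCount (Torus.geometry (Fin 3)) (hsDiameter σ N) ξs z (a' + h)),
                if a' < (lambertInstant (Torus.geometry (Fin 3)) (hsDiameter σ N) ξs z (m + 1)).toReal then
                  ∑ q : Fin (N + 1) × Fin (N + 1),
                    (incomingPairs (Torus.geometry (Fin 3)) (hsDiameter σ N)
                      (freeFlight (Torus.geometry (Fin 3))
                        (freeExitTime (Torus.geometry (Fin 3)) (hsDiameter σ N)
                          (lambertStateAfter (Torus.geometry (Fin 3)) (hsDiameter σ N) ξs z m)).toReal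
                        (lambertStateAfter (Torus.geometry (Fin 3)) (hsDiameter σ N) ξs z m))).indicator
                      (fun q' => wt q' (lambertStateAfter (Torus.geometry (Fin 3)) (hsDiameter σ N) ξs z m)) q
                else 0) ≤
              ∑ j ∈ Finset.range (n + 1), ∑ q : Fin (N + 1) × Fin (N + 1),
                (if q.1 ≠ q.2 ∧
                    hsDiameter σ N ≤ ‖(Torus.geometry (Fin 3)).sepVec
                      (lambertFlow (Torus.geometry (Fin 3)) (hsDiameter σ N) ξs z (a' + (j : ℝ) * (h / ((n : ℝ) + 1))) q.1).1
                      (lambertFlow (Torus.geometry (Fin 3)) (hsDiameter σ N) ξs z (a' + (j : ℝ) * (h / ((n : ℝ) + 1))) q.2).1‖ ∧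
                    ‖(Torus.geometry (Fin 3)).sepVec
                      (lambertFlow (Torus.geometry (Fin 3)) (hsDiameter σ N) ξs z (a' + (j : ℝ) * (h / ((n : ℝ) + 1))) q.1).1
                      (lambertFlow (Torus.geometry (Fin 3)) (hsDiameter σ N) ξs z (a' + (j : ℝ) * (h / ((n : ℝ) + 1))) q.2).1‖ ≤
                      hsDiameter σ N + (h / ((n : ℝ) + 1)) *
                        ‖(lambertFlow (Torus.geometry (Fin 3)) (hsDiameter σ N) ξs z (a' + (j : ℝ) * (h / ((n : ℝ) + 1))) q.1).2 -
                          (lambertFlow (Torus.geometry (Fin 3)) (hsDiameter σ N) ξs z (a' + (j : ℝ) * (h / ((n : ℝ) + 1))) q.2).2‖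
                  then wt q (lambertFlow (Torus.geometry (Fin 3)) (hsDiameter σ N) ξs z (a' + (j : ℝ) * (h / ((n : ℝ) + 1))))
                  else 0) := by
  intro σ _ _ N z ξs _ hpos hacc hsimple wt hwt0 hwtv a' h ha' hh
  exact markedContacts_le_meshSum_of_lipschitz
    (fun y s i j => LambertianContactSwapLambertianEulerFirstCollision.norm_sepVec_le_norm_sepVec_freeFlight_add
      y s i j)
    hpos hacc hsimple wt hwt0 hwtv ha' hh

end Summit.AtomisticToContinuum.HydrodynamicLimit.Theorems.LambertianContactSwapLambertianEulerMarkedKorolyuk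

end
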